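import Literature.AlgebraicGeometry.Resolution.GeneralizedStabilityFiniteRankDescent
import Literature.AlgebraicGeometry.Resolution.GeneralizedStabilityFiniteRankLemmas
import Mathlib.FieldTheory.Normal.Closure
import Mathlib.FieldTheory.IsAlgClosed.AlgebraicClosure
import Mathlib.FieldTheory.AlgebraicClosure
import HarnessLib

/-!
# Kuhlmann 2010, Lemma 5.3 (reduction of (R2) to ground fields of finite rank) — proof

Topic: `Literature/AlgebraicGeometry/Resolution` (valued function fields). A second, independent
PROOF route for the named fact `Kuhlmann2010AlgClosedFiniteRankReduction`
(`GeneralizedStabilityFiniteRank.lean`; discharged in the tree by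
`Kuhlmann2010AlgClosedFiniteRankReduction_holds`, `GeneralizedStabilityReductionProofs.lean`) =
F.-V. Kuhlmann, *Elimination of ramification I: The generalized stability theorem*, Trans. AMS
362 (2010) 5697–5727 = arXiv:1003.5678, **Lemma 5.3** ("To prove (R2), it suffices to prove
(R3)"), i.e.: for `K` algebraically closed, `F = K(t)` with `t` value-transcendental for
`O = F°`, if `(k(t), O ∩ k(t))` is a defectless field for every algebraically closed `k ⊆ K`
over which `k(t)` has finite rank, then `(F, O)` is a defectless field.

## Proof (pp. 18 of arXiv:1003.5678, with henselizations replaced by conjugacy)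

Printed proof: pass to the henselization `K(t)^h` (Thm. 2.14); a finite extension
`K(t)^h(a₁,…,a_n)` descends to `k(t)^h(a₁,…,a_n)` for `k` the algebraic closure in `K` of a
finitely generated field `k₁`, of finite rank by Cor. 2.7; `(K(t)^h | k(t)^h)` is valuation
regular (Lemmas 2.20, 2.23, Cor. 2.21), so Prop. 2.24 gives
`d(K(t)^h(a) | K(t)^h) ≤ d(k(t)^h(a) | k(t)^h) = 1`. Here (everything PROVED):

1. `IsDefectlessIn.of_tower` reduces to finite NORMAL extensions `L | F` (normal closure).
2. For an `F`-basis `b` of `L`, the finitely many structure constants, unit coordinates,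
   coefficients of the minimal polynomials of the `bᵢ` and coordinates of their roots lie in
   `k₁(t)` for a finite `s ⊆ K`, `k₁` the field generated by `s` (`exists_finset_forall_mem_closure`);
   `k :=` the algebraic closure of `k₁` in `K` is algebraically closed, and `M = k(t)` has finite
   rank by **Cor. 2.7** (`finite_overrings_of_isAlgebraic_closure`, `FiniteRankOverPrimeField.lean`,
   and `finite_overrings_of_valueTranscendental`), so `(M, O ∩ M)` is defectless by hypothesis.
3. `L₀ = M(b)` is finite normal over `M` with `[L₀ : M] = [L : F]`, and every `M`-automorphism
   of `L₀` extends to `L` (`GeneralizedStabilityFiniteRankDescent.lean`); defectlessness gives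
   `∑_{W₀ | O ∩ M} e(W₀) f(W₀) = [L : F]`.
4. Each `W₀` is the trace of an extension `W` of `O` to `L` (`exists_comap_eq_and_comap_eq`:
   Chevalley and the CONJUGACY of the extensions of `O ∩ M` in the normal extension `L₀ | M`,
   Zariski–Samuel II VI §7 Thm. 12 Cor. 3 — in place of the uniqueness of the extension to the
   henselization), distinct `W₀` giving distinct `W`.
5. The local inequality of Prop. 2.24: `f(W₀) = 1` (the residue field of `M = k(t)` is that of
   `k`, algebraically closed: Lemma 2.5 / Lemma 2.1) and `e(W₀) ≤ e(W)` because
   `vL₀ ∩ vF = vM` inside `vL` (`exists_valuation_eq_of_descent`: `vF = vK ⊕ ℤvt`,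
   `vM = vk ⊕ ℤvt`, `vk` divisible and `vL₀/vM` torsion — the valuation regularity of `K | k`,
   Lemma 2.20, and the disjointness of Lemma 2.19).
6. Hence `∑_{W | O} e(W) f(W) ≥ [L : F]`, and the fundamental inequality
   (`FundamentalInequality_holds`) gives equality: `(F, O)` is defectless in `L`.

## Content

* `exists_finset_mem_closure`, `exists_finset_forall_mem_closure` — elements of `K(t)` lie in
  `k₁(t)` for finitely generated `k₁ ⊆ K`.
* `exists_valuation_eq_of_descent` — step 5, `vL₀ ∩ vF ⊆ vM`.
* `isDefectlessIn_of_normal` — steps 2–6 for `L | F` finite normal; with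
  `IsDefectlessIn.of_tower` this yields the named fact (closing `example`).

## Sources

* F.-V. Kuhlmann, loc. cit., §2.1 (Lemma 2.5, Cor. 2.7), §2.4 (Lemmas 2.19–2.23, Prop. 2.24),
  §5 (Lemma 5.3), pp. 5–8, 18 of arXiv:1003.5678.
* O. Zariski, P. Samuel, *Commutative Algebra* II (1960), Ch. VI §7, Thm. 12, Cor. 3.
-/

noncomputable section

open IsLocalRing
open scoped Pointwise

namespace Literature.AlgebraicGeometry.Resolution

universe u

/-! ### Elements of `K(t)` live in finitely generated subfields -/

section Finitary

variable {K F : Type u} [Field K] [Field F] [Algebra K F] {t : F}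

/-- Every element of `F = K(t)` lies in `k₁(t)` for the subfield `k₁ ⊆ K` generated by finitely
many elements (the coefficients of a representation `x = r(t)/q(t)`). [folklore] -/
theorem exists_finset_mem_closure (hgen : IntermediateField.adjoin K ({t} : Set F) = ⊤) (x : F) :
    ∃ s : Finset K, x ∈ Subfield.closure ((algebraMap K F) '' (s : Set K) ∪ {t}) := by
  classical
  have hx : x ∈ IntermediateField.adjoin K ({t} : Set F) := by
    rw [hgen]
    exact IntermediateField.mem_top
  rw [IntermediateField.mem_adjoin_simple_iff] at hx
  obtain ⟨r, q, rfl⟩ := hx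
  refine ⟨r.coeffs ∪ q.coeffs, ?_⟩
  set S := Subfield.closure ((algebraMap K F) '' ((r.coeffs ∪ q.coeffs : Finset K) : Set K) ∪ {t})
    with hS
  have ht : t ∈ S := Subfield.subset_closure (Set.mem_union_right _ rfl)
  have haeval : ∀ p : Polynomial K, p.coeffs ⊆ r.coeffs ∪ q.coeffs →
      Polynomial.aeval t p ∈ S := by
    intro p hp
    rw [Polynomial.aeval_eq_sum_range]
    refine sum_mem fun i _ => ?_
    rw [Algebra.smul_def]
    refine mul_mem ?_ (pow_mem ht i)
    by_cases h0 : p.coeff i = 0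
    · rw [h0, map_zero]
      exact zero_mem S
    · exact Subfield.subset_closure (Set.mem_union_left _
        ⟨p.coeff i, Finset.mem_coe.mpr (hp (Polynomial.coeff_mem_coeffs h0)), rfl⟩)
  exact div_mem (haeval r Finset.subset_union_left) (haeval q Finset.subset_union_right)

/-- Finitely many elements of `F = K(t)` lie in a common `k₁(t)`, `k₁ ⊆ K` finitely generated.
[folklore] -/
theorem exists_finset_forall_mem_closure (hgen : IntermediateField.adjoin K ({t} : Set F) = ⊤)
    (T : Finset F) :
    ∃ s : Finset K, ∀ x ∈ T, x ∈ Subfield.closure ((algebraMap K F) '' (s : Set K) ∪ {t}) := by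
  classical
  choose s hs using fun x : F => exists_finset_mem_closure hgen x
  refine ⟨T.biUnion s, fun x hx => Subfield.closure_mono ?_ (hs x)⟩
  refine Set.union_subset_union_left _ (Set.image_mono fun c hc => ?_)
  exact Finset.mem_coe.mpr (Finset.mem_biUnion.mpr ⟨x, hx, hc⟩)

end Finitary

/-! ### Step 5: the value groups of `L₀` and `F` meet inside that of `M = k(t)` -/

section Disjoint

variable {K F : Type u} [Field K] [Field F] [Algebra K F] {t : F}
  {k : Type u} [Field k] [Algebra k K] [Algebra k F] [IsScalarTower k K F] [IsAlgClosed k]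

/-- Transport of a valuation identity along `F → L`. [folklore] -/
private theorem valuation_algebraMap_eq_of_comap {L : Type u} [Field L] [Algebra F L]
    (W : ValuationSubring L) {x y : F} {m : ℤ} {z : F}
    (h : (W.comap (algebraMap F L)).valuation x =
      (W.comap (algebraMap F L)).valuation y * (W.comap (algebraMap F L)).valuation z ^ m) :
    W.valuation (algebraMap F L x) =
      W.valuation (algebraMap F L y) * W.valuation (algebraMap F L z) ^ m := by
  have h1 := congrArg (valueGroupHom F W) h
  rwa [map_mul, map_zpow₀, valueGroupHom_valuation, valueGroupHom_valuation,
    valueGroupHom_valuation] at h1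

/-- **`vL₀ ∩ vF ⊆ vM` inside `vL`** (step 5 of the module docstring; Kuhlmann 2010,
Lemma 2.19 (1) with Lemma 2.20 and Lemma 2.23 for `(K(t) | k(t), v)`): let `K` and `k ⊆ K` be
algebraically closed, `F = K(t)` with `t` value-transcendental for `W ∩ F`, `M = k(t) ⊆ F`
(any intermediate field generated by `t` over `k`), and `L₀ ⊆ L` finite over `M`. If the value of `c ∈ F^×` is the value of an element of `L₀`,
then it is the value of an element of `M`: writing `v(c) = v(a)·v(t)^m` (`a ∈ K`,
`vK(t) = vK ⊕ ℤvt`) and `N·v(y) ∈ vM = vk ⊕ ℤvt` for `y ∈ L₀` (`[L₀ : M] < ∞`), rational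
independence of `vt` gives `N·v(a) ∈ vk`, and divisibility of `vk` gives `v(a) ∈ vk`. PROVED.
[cite: Kuhlmann2010, Lemma 2.19, Lemma 2.20, Lemma 2.23] -/
theorem exists_valuation_eq_of_descent {L : Type u} [Field L] [Algebra F L]
    (M : IntermediateField k F) (htM : t ∈ M)
    (hgenM : IntermediateField.adjoin k ({(⟨t, htM⟩ : M)} : Set M) = ⊤)
    (L₀ : IntermediateField M L) [FiniteDimensional M L₀] (W : ValuationSubring L)
    (hvt : ∀ n : ℕ, 0 < n → ∀ c : K, (W.comap (algebraMap F L)).valuation t ^ n ≠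
      (W.comap (algebraMap F L)).valuation (algebraMap K F c))
    (hgen : IntermediateField.adjoin K ({t} : Set F) = ⊤)
    (c : F) (y : L₀) (hc0 : c ≠ 0)
    (hcy : W.valuation (algebraMap L₀ L y) = W.valuation (algebraMap F L c)) :
    ∃ c₀ : M, W.valuation (algebraMap M L c₀) = W.valuation (algebraMap F L c) := by
  have hML : ∀ x : M, algebraMap M L x = algebraMap F L (algebraMap M F x) := fun x =>
    IsScalarTower.algebraMap_apply M F L x
  have htF : algebraMap M F (⟨t, htM⟩ : M) = t := rfl
  -- `t` is value-transcendental over `k` for `W ∩ M`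
  have hvtM : ∀ n : ℕ, 0 < n → ∀ a : k, (W.comap (algebraMap M L)).valuation (⟨t, htM⟩ : M) ^ n ≠
      (W.comap (algebraMap M L)).valuation (algebraMap k M a) := by
    intro n hn a h
    have h1 := congrArg (valueGroupHom M W) h
    rw [map_pow, valueGroupHom_valuation, valueGroupHom_valuation, hML, hML, htF,
      ← IsScalarTower.algebraMap_apply k M F, IsScalarTower.algebraMap_apply k K F] at h1
    apply hvt n hn (algebraMap k K a)
    apply valueGroupHom_injective F W
    rw [map_pow, valueGroupHom_valuation, valueGroupHom_valuation]
    exact h1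
  -- (1) `v(c) = v(a) v(t)^m` with `a ∈ K`
  obtain ⟨m, a, ha⟩ := exists_valuation_eq_of_valueTranscendental (W.comap (algebraMap F L)) hvt hgen hc0
  have ha' : W.valuation (algebraMap F L c) = W.valuation (algebraMap F L (algebraMap K F a)) *
      W.valuation (algebraMap F L t) ^ m := valuation_algebraMap_eq_of_comap W ha
  have hva0 : W.valuation (algebraMap F L (algebraMap K F a)) ≠ 0 := by
    intro h0
    rw [h0, zero_mul] at ha'
    exact (map_ne_zero W.valuation).mpr ((map_ne_zero _).mpr hc0) ha'
  -- (2) `N v(y) ∈ vM`: `v(y)^N = v(c₁)`, `c₁ ∈ M`, `N ≥ 1`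
  have hy0 : y ≠ 0 := by
    rintro rfl
    rw [map_zero, map_zero] at hcy
    exact (map_ne_zero W.valuation).mpr ((map_ne_zero _).mpr hc0) hcy.symm
  obtain ⟨hfi, -, -⟩ := ramificationIndex_mul_inertiaDegree_le_finrank M (W.comap (algebraMap L₀ L))
  haveI := hfi
  have hvy0 : (W.comap (algebraMap L₀ L)).valuation y ≠ 0 := (Valuation.ne_zero_iff _).mpr hy0
  obtain ⟨N, hN0, -, hN⟩ := Subgroup.exists_pow_mem_of_index_ne_zero
    (Subgroup.FiniteIndex.index_ne_zero (H := valueSubgroup M (W.comap (algebraMap L₀ L))))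
    (Units.mk0 _ hvy0)
  obtain ⟨c₁, hc₁0, hc₁⟩ := (mem_valueSubgroup_iff M (W.comap (algebraMap L₀ L)) _).mp hN
  rw [Units.val_pow_eq_pow_val, Units.val_mk0] at hc₁
  have hc₁' : W.valuation (algebraMap L₀ L y) ^ N = W.valuation (algebraMap M L c₁) := by
    have h1 := congrArg (valueGroupHom L₀ W) hc₁
    rwa [map_pow, valueGroupHom_valuation, valueGroupHom_valuation,
      ← IsScalarTower.algebraMap_apply M L₀ L] at h1
  -- (3) `v(c₁) = v(a₁) v(t)^{m₁}` with `a₁ ∈ k`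
  obtain ⟨m₁, a₁, ha₁⟩ := exists_valuation_eq_of_valueTranscendental (W.comap (algebraMap M L))
    hvtM hgenM hc₁0
  have ha₁' : W.valuation (algebraMap M L c₁) =
      W.valuation (algebraMap F L (algebraMap K F (algebraMap k K a₁))) *
        W.valuation (algebraMap F L t) ^ m₁ := by
    have h1 := congrArg (valueGroupHom M W) ha₁
    rw [map_mul, map_zpow₀, valueGroupHom_valuation, valueGroupHom_valuation,
      valueGroupHom_valuation, hML (algebraMap k M a₁), hML ⟨t, htM⟩, htF,
      ← IsScalarTower.algebraMap_apply k M F, IsScalarTower.algebraMap_apply k K F] at h1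
    exact h1
  -- (4) compare: `v(t)^{mN - m₁} = v(a₁ / a^N)`, hence `m N = m₁`
  set vt := W.valuation (algebraMap F L t) with hvt'
  set va := W.valuation (algebraMap F L (algebraMap K F a)) with hva
  set va₁ := W.valuation (algebraMap F L (algebraMap K F (algebraMap k K a₁))) with hva₁
  have hvt0 : vt ≠ 0 := (map_ne_zero W.valuation).mpr ((map_ne_zero _).mpr
    (ne_zero_of_valueTranscendental (W.comap (algebraMap F L)) hvt))
  have hkey : va ^ N * vt ^ (m * N) = va₁ * vt ^ m₁ := by
    rw [← ha₁', ← hc₁', hcy, ha', mul_pow, ← zpow_natCast (vt ^ m), ← zpow_mul]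
  have hva₁0 : va₁ ≠ 0 := by
    intro h0
    rw [h0, zero_mul, mul_eq_zero] at hkey
    rcases hkey with h | h
    · exact pow_ne_zero _ hva0 h
    · exact zpow_ne_zero _ hvt0 h
  have hzpow : vt ^ (m * N - m₁) = va₁ / va ^ N := by
    rw [zpow_sub₀ hvt0, div_eq_div_iff (zpow_ne_zero _ hvt0) (pow_ne_zero _ hva0), mul_comm]
    exact hkey
  have hmN : m * N - m₁ = 0 := by
    apply eq_zero_of_valuation_zpow_eq (W.comap (algebraMap F L)) hvt (m * N - m₁)
      (algebraMap k K a₁ / a ^ N)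
    apply valueGroupHom_injective F W
    simp only [map_zpow₀, map_div₀, map_pow, valueGroupHom_valuation]
    exact hzpow
  -- hence `v(a)^N = v(a₁)`, and `v(a) = v(a₂)` for an `N`-th root `a₂` of `a₁` in `k`
  have hvaN : va ^ N = va₁ := by
    have h1 : vt ^ (m * N - m₁) = 1 := by rw [hmN, zpow_zero]
    rw [h1, eq_comm, div_eq_one_iff_eq (pow_ne_zero _ hva0)] at hzpow
    exact hzpow.symm
  obtain ⟨a₂, ha₂⟩ := IsAlgClosed.exists_pow_nat_eq a₁ hN0
  have hva₂ : va = W.valuation (algebraMap F L (algebraMap K F (algebraMap k K a₂))) := by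
    apply valuation_eq_of_pow_eq W (Nat.pos_iff_ne_zero.mp hN0)
    rw [hvaN, hva₁, ← map_pow, ← map_pow, ← map_pow, ← map_pow, ha₂]
  -- the element `c₀ = a₂ t^m ∈ M`
  refine ⟨algebraMap k M a₂ * (⟨t, htM⟩ : M) ^ m, ?_⟩
  simp only [map_mul, map_zpow₀]
  rw [hML, hML, htF, ← IsScalarTower.algebraMap_apply k M F,
    IsScalarTower.algebraMap_apply k K F, ← hva₂, ha']

end Disjoint

/-! ### Lemma 5.3 for a finite normal extension of `K(t)` -/

section Main

variable {K F : Type u} [Field K] [Field F] [Algebra K F] [IsAlgClosed K] (O : ValuationSubring F)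
  {t : F}
  (hvt : ∀ n : ℕ, 0 < n → ∀ c : K, O.valuation t ^ n ≠ O.valuation (algebraMap K F c))
  (hgen : IntermediateField.adjoin K ({t} : Set F) = ⊤)
  (H : ∀ (k : Type u) [Field k] [Algebra k K] [Algebra k F] [IsScalarTower k K F] [IsAlgClosed k],
      Finite {S : ValuationSubring (IntermediateField.adjoin k ({t} : Set F)) //
        O.comap (algebraMap (IntermediateField.adjoin k ({t} : Set F)) F) ≤ S} →
      IsDefectlessField (IntermediateField.adjoin k ({t} : Set F))
        (O.comap (algebraMap (IntermediateField.adjoin k ({t} : Set F)) F)))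

include hvt hgen H

/-- **Kuhlmann 2010, Lemma 5.3, for a finite normal extension `L | F = K(t)`**: under the
hypotheses of `Kuhlmann2010AlgClosedFiniteRankReduction`, `(F, O)` is defectless in every
finite normal extension `L` (steps 2–6 of the module docstring). PROVED.
[cite: Kuhlmann2010, Lemma 5.3 (proof), with Cor. 2.7, Lemma 2.19, Lemma 2.20, Prop. 2.24] -/
theorem isDefectlessIn_of_normal (L : Type u) [Field L] [Algebra F L] [FiniteDimensional F L]
    [Normal F L] : IsDefectlessIn F O L := by
  classical
  -- (1) an `F`-basis of `L` and the finite set of elements of `F` to descend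
  let b : Module.Basis (Fin (Module.finrank F L)) F L := Module.finBasis F L
  let Tmul : Finset F :=
    (Finset.univ : Finset (Fin (Module.finrank F L) × Fin (Module.finrank F L) ×
      Fin (Module.finrank F L))).image fun p => b.repr (b p.1 * b p.2.1) p.2.2
  let Tone : Finset F := (Finset.univ : Finset (Fin (Module.finrank F L))).image fun l => b.repr 1 l
  let Tmin : Finset F :=
    (Finset.univ : Finset (Fin (Module.finrank F L))).biUnion fun i => (minpoly F (b i)).coeffs
  let Troot : Finset F := (Finset.univ : Finset (Fin (Module.finrank F L))).biUnion fun i =>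
    ((minpoly F (b i)).rootSet L).toFinset.biUnion fun x =>
      (Finset.univ : Finset (Fin (Module.finrank F L))).image fun l => b.repr x l
  let T : Finset F := Tmul ∪ Tone ∪ Tmin ∪ Troot
  obtain ⟨s, hs⟩ := exists_finset_forall_mem_closure hgen T
  -- (2) the small algebraically closed field `k` and `M = k(t)`
  let k₁ : Subfield K := Subfield.closure (s : Set K)
  let k : IntermediateField k₁ K := algebraicClosure k₁ K
  haveI : IsAlgClosed k := IsAlgClosure.isAlgClosed k₁
  let M : IntermediateField k F := IntermediateField.adjoin k ({t} : Set F)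
  have htM : t ∈ M := IntermediateField.subset_adjoin _ _ rfl
  have hsM : (algebraMap K F) '' (s : Set K) ∪ {t} ⊆ (M.toSubfield : Set F) := by
    rintro x (⟨c, hc, rfl⟩ | rfl)
    · have hck₁ : c ∈ k₁ := Subfield.subset_closure hc
      have hck : c ∈ k := mem_algebraicClosure_iff.mpr (isAlgebraic_algebraMap (⟨c, hck₁⟩ : k₁))
      exact M.algebraMap_mem ⟨c, hck⟩
    · exact htM
  have hTM : ∀ x ∈ T, x ∈ (algebraMap M F).range := fun x hx =>
    ⟨⟨x, Subfield.closure_le.mpr hsM (hs x hx)⟩, rfl⟩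
  have hmem_mul : ∀ i j l, b.repr (b i * b j) l ∈ T := fun i j l =>
    Finset.mem_union_left _ (Finset.mem_union_left _ (Finset.mem_union_left _
      (Finset.mem_image.mpr ⟨(i, j, l), Finset.mem_univ _, rfl⟩)))
  have hmem_one : ∀ l, b.repr 1 l ∈ T := fun l =>
    Finset.mem_union_left _ (Finset.mem_union_left _ (Finset.mem_union_right _
      (Finset.mem_image.mpr ⟨l, Finset.mem_univ _, rfl⟩)))
  have hmem_min : ∀ i m, (minpoly F (b i)).coeff m ≠ 0 → (minpoly F (b i)).coeff m ∈ T :=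
    fun i m hm => Finset.mem_union_left _ (Finset.mem_union_right _
      (Finset.mem_biUnion.mpr ⟨i, Finset.mem_univ _, Polynomial.coeff_mem_coeffs hm⟩))
  have hmem_root : ∀ i, ∀ x ∈ (minpoly F (b i)).rootSet L, ∀ l, b.repr x l ∈ T :=
    fun i x hx l => Finset.mem_union_right _ (Finset.mem_biUnion.mpr ⟨i, Finset.mem_univ _,
      Finset.mem_biUnion.mpr ⟨x, Set.mem_toFinset.mpr hx,
        Finset.mem_image.mpr ⟨l, Finset.mem_univ _, rfl⟩⟩⟩)
  -- (3) the hypotheses of the descent lemmas for `F₀ = M`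
  have hmul : ∀ i j l, b.repr (b i * b j) l ∈ (algebraMap M F).range :=
    fun i j l => hTM _ (hmem_mul i j l)
  have hone : ∀ l, b.repr 1 l ∈ (algebraMap M F).range := fun l => hTM _ (hmem_one l)
  have hmin : ∀ i, ∃ q : Polynomial M, q ≠ 0 ∧ q.map (algebraMap M F) = minpoly F (b i) := by
    intro i
    have hlift : minpoly F (b i) ∈ Polynomial.lifts (algebraMap M F) := by
      rw [Polynomial.lifts_iff_coeff_lifts]
      intro m
      by_cases h0 : (minpoly F (b i)).coeff m = 0
      · rw [h0]
        exact ⟨0, map_zero _⟩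
      · obtain ⟨y, hy⟩ := hTM _ (hmem_min i m h0)
        exact ⟨y, hy⟩
    obtain ⟨q, hq⟩ := (Polynomial.mem_lifts _).mp hlift
    refine ⟨q, ?_, hq⟩
    rintro rfl
    rw [Polynomial.map_zero] at hq
    exact minpoly.ne_zero (IsIntegral.of_finite F (b i)) hq.symm
  have halg : ∀ i, IsAlgebraic M (b i) := fun i => by
    obtain ⟨q, hq0, hq⟩ := hmin i
    refine ⟨q, hq0, ?_⟩
    rw [← Polynomial.aeval_map_algebraMap F, hq]
    exact minpoly.aeval F (b i)
  have hroots : ∀ i, ∀ x ∈ (minpoly F (b i)).rootSet L, ∀ l,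
      b.repr x l ∈ (algebraMap M F).range := fun i x hx l => hTM _ (hmem_root i x hx l)
  -- (4) the descended field `L₀ = M(b)`: finite normal over `M`, `[L₀ : M] = [L : F]`
  let L₀ : IntermediateField M L := IntermediateField.adjoin M (Set.range b)
  haveI : FiniteDimensional M L₀ := finiteDimensional_adjoin_range hmul hone halg
  haveI : Normal M L₀ := normal_adjoin_range hmul hone halg hmin hroots
  have hfinrank : Module.finrank M L₀ = Module.finrank F L := finrank_adjoin_range_eq hmul hone halg
  have hlift : ∀ τ : L₀ ≃ₐ[M] L₀, ∃ σ : L ≃ₐ[F] L,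
      ∀ x : L₀, σ (algebraMap L₀ L x) = algebraMap L₀ L (τ x) :=
    fun τ => exists_algEquiv_extends hmul hone halg τ
  -- (5) finite rank of `M = k(t)`: `k` has finite rank by Cor. 2.7
  let OM : ValuationSubring M := O.comap (algebraMap M F)
  have hvtM : ∀ n : ℕ, 0 < n → ∀ c : k,
      OM.valuation (⟨t, htM⟩ : M) ^ n ≠ OM.valuation (algebraMap k M c) := by
    intro n hn c h
    have h' : O.valuation t ^ n = O.valuation (algebraMap k F c) := by
      have h1 := congrArg (valueGroupHom M O) h
      rw [map_pow, valueGroupHom_valuation, valueGroupHom_valuation,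
        ← IsScalarTower.algebraMap_apply k M F] at h1
      exact h1
    refine hvt n hn (algebraMap k K c) ?_
    rw [h', IsScalarTower.algebraMap_apply k K F]
  have hgenM : IntermediateField.adjoin k ({(⟨t, htM⟩ : M)} : Set M) = ⊤ := by
    apply IntermediateField.lift_injective M
    rw [IntermediateField.lift_adjoin, IntermediateField.lift_top, Set.image_singleton]
  have hfink : Finite {S : ValuationSubring k // OM.comap (algebraMap k M) ≤ S} := by
    let sk : Set k := (algebraMap k K) ⁻¹' (s : Set K)
    have hsk : sk.Finite := s.finite_toSet.preimage fun _ _ _ _ h => (algebraMap k K).injective h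
    refine finite_overrings_of_isAlgebraic_closure _ hsk fun y => ?_
    have hy : IsAlgebraic k₁ (y : K) := mem_algebraicClosure_iff.mp y.2
    have hle : ∀ z ∈ Subfield.closure sk, algebraMap k K z ∈ k₁ := by
      intro z hz
      refine (Subfield.closure_le (t := k₁.comap (algebraMap k K))).mpr ?_ hz
      intro w hw
      exact Subfield.subset_closure hw
    let f : Subfield.closure sk →+* k₁ := (algebraMap k K).restrict (Subfield.closure sk) k₁ hle
    have hf : Function.Surjective f := by
      rintro ⟨w, hw⟩
      have hw' : w ∈ (Subfield.closure sk).map (algebraMap k K) := by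
        rw [RingHom.map_field_closure]
        refine Subfield.closure_mono ?_ hw
        intro c hc
        have hck : c ∈ k := mem_algebraicClosure_iff.mpr
          (isAlgebraic_algebraMap (⟨c, Subfield.subset_closure hc⟩ : k₁))
        exact ⟨⟨c, hck⟩, hc, rfl⟩
      obtain ⟨z, hz, hzw⟩ := Subfield.mem_map.mp hw'
      exact ⟨⟨z, hz⟩, Subtype.ext hzw⟩
    exact IsAlgebraic.of_ringHom_of_comp_eq f (algebraMap k K) hy hf (algebraMap k K).injective
      (RingHom.ext fun _ => rfl)
  haveI hfinM : Finite {S : ValuationSubring M // OM ≤ S} := by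
    haveI := hfink
    exact finite_overrings_of_valueTranscendental OM hvtM hgenM
  -- (6) `(M, OM)` is defectless, in particular in `L₀`
  have hdef : IsDefectlessField M OM := H k hfinM
  obtain ⟨sk₀, hsk₀, hsum₀⟩ := hdef L₀ inferInstance
  -- (7) the extensions of `O` to `L`; lift each `W₀ ∈ sk₀` (conjugacy in `L₀ | M`)
  obtain ⟨sL, hsL, hleL⟩ := FundamentalInequality_holds F L inferInstance O
  have hW₀O : ∀ W₀ ∈ sk₀, W₀.comap (algebraMap M L₀) = O.comap (algebraMap M F) :=
    fun W₀ h => (hsk₀ W₀).mp h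
  have hex : ∀ W₀ : ValuationSubring L₀, W₀ ∈ sk₀ → ∃ W : ValuationSubring L,
      W.comap (algebraMap F L) = O ∧ W.comap (algebraMap L₀ L) = W₀ := fun W₀ hW₀ =>
    exists_comap_eq_and_comap_eq (F := F) (L := L) hlift O W₀ (hW₀O W₀ hW₀)
  choose! Φ hΦF hΦL₀ using hex
  have hΦmem : ∀ W₀ ∈ sk₀, Φ W₀ ∈ sL := fun W₀ h => (hsL _).mpr (hΦF W₀ h)
  have hΦinj : Set.InjOn Φ sk₀ := fun W₁ h₁ W₂ h₂ heq => by
    rw [← hΦL₀ W₁ h₁, ← hΦL₀ W₂ h₂, heq]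
  -- (8) the local inequality `e₀ f₀ ≤ e f` (`f₀ = 1`, `e₀ ≤ e`)
  have hres : IsAlgClosed (ResidueField OM) :=
    isAlgClosed_residueField_of_residueSubfield_eq_top (K := k) OM
      (residueSubfield_eq_top_of_valueTranscendental OM hvtM hgenM)
  have hlocal : ∀ W₀ ∈ sk₀, ramificationIndex M W₀ * inertiaDegree M W₀ ≤
      ramificationIndex F (Φ W₀) * inertiaDegree F (Φ W₀) := by
    intro W₀ hW₀
    have hvt' : ∀ n : ℕ, 0 < n → ∀ c : K, ((Φ W₀).comap (algebraMap F L)).valuation t ^ n ≠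
        ((Φ W₀).comap (algebraMap F L)).valuation (algebraMap K F c) := by
      rw [hΦF W₀ hW₀]
      exact hvt
    haveI : IsAlgClosed (ResidueField (W₀.comap (algebraMap M L₀))) := by
      rw [hW₀O W₀ hW₀]
      exact hres
    have hf₀ : inertiaDegree M W₀ = 1 := inertiaDegree_eq_one_of_isAlgClosed_residueField W₀
    have he : ramificationIndex M W₀ ≤ ramificationIndex F (Φ W₀) := by
      have h1 := ramificationIndex_comap_le_of_disjoint (F₀ := M) (F := F) (Φ W₀)
        fun c y hc0 hcy => exists_valuation_eq_of_descent M htM hgenM L₀ (Φ W₀) hvt' hgen c y hc0 hcy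
      rwa [hΦL₀ W₀ hW₀] at h1
    have hf : 1 ≤ inertiaDegree F (Φ W₀) := (one_le_ramificationIndex_and_inertiaDegree F (Φ W₀)).2
    rw [hf₀, mul_one]
    exact le_trans he (Nat.le_mul_of_pos_right _ hf)
  -- (9) summation against the fundamental inequality
  refine ⟨sL, hsL, le_antisymm hleL ?_⟩
  calc Module.finrank F L = Module.finrank M L₀ := hfinrank.symm
    _ = ∑ W₀ ∈ sk₀, ramificationIndex M W₀ * inertiaDegree M W₀ := hsum₀.symm
    _ ≤ ∑ W₀ ∈ sk₀, ramificationIndex F (Φ W₀) * inertiaDegree F (Φ W₀) :=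
        Finset.sum_le_sum hlocal
    _ = ∑ W ∈ sk₀.image Φ, ramificationIndex F W * inertiaDegree F W :=
        (Finset.sum_image (f := fun W => ramificationIndex F W * inertiaDegree F W) hΦinj).symm
    _ ≤ ∑ W ∈ sL, ramificationIndex F W * inertiaDegree F W :=
        Finset.sum_le_sum_of_subset (Finset.image_subset_iff.mpr hΦmem)

end Main

/-! ### The named fact

`Kuhlmann2010AlgClosedFiniteRankReduction` was discharged in the tree by
`Kuhlmann2010AlgClosedFiniteRankReduction_holds` (`GeneralizedStabilityReductionProofs.lean`,
through `IsDefectlessIn.of_form` of `DefectLinearlyDisjoint.lean` and Cor. 2.7 of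
`FiniteRankOverPrimeField.lean`) while this file was being written; the present route gives it
independently in two lines, recorded here as an `example` so as not to duplicate the name:
reduce a finite extension to its normal closure (`IsDefectlessIn.of_tower`) and apply
`isDefectlessIn_of_normal`. -/

example : Kuhlmann2010AlgClosedFiniteRankReduction.{u} := by
  intro K F _ _ _ _ O t hvt hgen H L _ _ hfin
  haveI := hfin
  haveI : IsAlgClosure F (AlgebraicClosure L) := IsAlgClosure.ofAlgebraic F L (AlgebraicClosure L)
  haveI : FiniteDimensional L (IntermediateField.normalClosure F L (AlgebraicClosure L)) :=
    Module.Finite.of_restrictScalars_finite F L _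
  exact IsDefectlessIn.of_tower O
    (isDefectlessIn_of_normal O hvt hgen H (IntermediateField.normalClosure F L (AlgebraicClosure L)))

end Literature.AlgebraicGeometry.Resolution
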